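/-
Copyright: the b2b-balaban cell (near-miss cell 7), T⁴-continuum fan-out; row NE7b ROUND-2 swarm, seat
t4-ne7b-formalise-leaf-02 (gen 3) — sub-row S6g′(a)-TOTAL, file 5 (the TOTAL packaged for realised pedigrees).
Released under the licence of the surrounding project.
-/
import Summits.QuantumFields.BalabanUV.T4Continuum.Support.HistoryZoneMassTotal
import Summits.QuantumFields.BalabanUV.T4Continuum.Support.HistoryZoneMassDatingGen
import Summits.QuantumFields.BalabanUV.T4Continuum.Support.HistoryChronoCanon

/-!
# The class-linear TOTAL for the tagged genealogy of a pedigree: «oldest line first» is the only display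
# (row S6g′(a)-TOTAL, file 5)

Summits-side support leaf of the T⁴-continuum cell (rung (B)+1 on a FINITE torus only; NOT infinite volume, NOT the
mass gap, NOT the Clay statement; NOT a proof of the spine estimate NE7b).  Row NE7b, route «COUNT», row S6g′
«MASS-BASED SIBLING COUNT».  The TOTAL `HistoryZoneMassTotal.finset_sum_joins_le` (p213527) takes `Chrono` and the
dating display `Dated … true T G`; for the object the instance ENDs realise — leaf-09's tagged genealogy `P.genT c` of a
pedigree, shapes read by `Prod.fst` — both follow from ONE displayed reading convention, «OLDEST LINE FIRST»
(`Pedigree.HeadOldest`, the field `headOldest` of `RealisedReading(R)` ∕ `RealisedDomains(R)`): the dating by file 4's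
`dated_strict_genT` (renewal strictness is unconditional, `renewStrict_genT`), the chronology by leaf-09's
`chronoC_genT` through leaf-06's `HistoryChronoCanon.chrono_of_canon`.  [folklore] composition BY NAME; nothing is
quoted from print, nothing printed is asserted, no `[cite:]` tag, no `Prop`-valued fact minted, constants symbolic.

WHAT.  `chronoZ_genT` (`HeadOldest ⇒ ZoneSkeleton.Chrono (PEv.step ∘ Prod.fst) (P.genT c)`), and the three ENDs on
`P.genT c` with hypotheses `0 ≤ θ < 1`, `0 ≤ WB`, `0 ≤ WM` (`0 ≤ γ`), `∀ c, P.HeadOldest c` ONLY: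
**`sum_joins_zmass_le_genT`** (`Σ_{X ∈ joins} zmass (ftime X) X ≤ umass ∕ (1 − θ)`), **`sum_joins_tparts_zmass_add_le_genT`**
(`Σ_{X ∈ joins} Σ_{Q ∈ tparts X} (zmass (ftime X) Q + γ) ≤ umass ∕ (1 − θ) + 2γ·nmerges`) and the finset form
**`finset_sum_joins_le_genT`** (= leaf-10 g3's `hZtot` ∕ leaf-05 g2's `MS` budget for the member `P.genT c`).  Sanity: closed
arithmetic (`umass`, `nmerges`) on the tagged tree of file 4's two-component toy.

HONEST SCOPE.  Bookkeeping over OUR carriers; the masses `zmass`∕`umass` are the law's currency (leaf-04 g2∕g3), their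
binding to Bałaban's regions is H3; `BirthShapeNodup` is NOT retired by this file; NE7b NOT proved; spine 0∕9.  HONEST
DEPENDENCY (cell): continuum YM on T⁴ ⇐ BetaPertH ∧ nine spine estimates (0/9 proved); BetaPertH ⇐ (D1) ∧ (D4) ∧
CAP+tail; G-an2-4 gates asym, D1 and NE2/3/4.  This file changes none of it.
-/

open Finset
open Literature.MathematicalPhysics.QuantumFieldTheory.Balaban1983to89
open T4PersistenceDictionary T4BranchingRecordsGas
open Summit.QuantumFields.BalabanUV.T4Continuum.ZoneSkeleton
open Summit.QuantumFields.BalabanUV.T4Continuum.ZoneTorus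
open Summit.QuantumFields.BalabanUV.T4Continuum.HistoryGen
open Summit.QuantumFields.BalabanUV.T4Continuum.HistoryChronoCanon
open Summit.QuantumFields.BalabanUV.T4Continuum.HistoryZoneMassLaw
open Summit.QuantumFields.BalabanUV.T4Continuum.HistoryZoneMassJoins
open Summit.QuantumFields.BalabanUV.T4Continuum.HistoryZoneMassTotal
open Summit.QuantumFields.BalabanUV.T4Continuum.HistoryZoneMassDatingGen

namespace Summit.QuantumFields.BalabanUV.T4Continuum.HistoryZoneMassTotalGen

noncomputable section

variable {α π : Type*} [DecidableEq α] [DecidableEq π] {P : Pedigree α π} {θ WB WM : ℝ}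

/-- **«OLDEST LINE FIRST» ⇒ the zone-side chronology of the tagged genealogy** (leaf-09's canonical chronology
`chronoC_genT` read through leaf-06's `HistoryChronoCanon.chrono_of_canon`). [folklore] -/
theorem chronoZ_genT (hH : ∀ c, P.HeadOldest c) (c : α) : ZoneSkeleton.Chrono (PEv.step ∘ Prod.fst) (P.genT c) :=
  chrono_of_canon (PEv.step ∘ Prod.fst) (Pedigree.chronoC_genT hH c)

/-- **THE TOTAL FOR A TAGGED GENEALOGY, LIST FORM**: `Σ_{X ∈ joins} zmass (ftime X) X ≤ umass ∕ (1 − θ)`, from «oldest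
line first» only. [folklore] -/
theorem sum_joins_zmass_le_genT (hθ0 : 0 ≤ θ) (hθ1 : θ < 1) (hB : 0 ≤ WB) (hM : 0 ≤ WM) (hH : ∀ c, P.HeadOldest c)
    (c : α) :
    ((joins (PEv.step ∘ Prod.fst) (P.genT c)).map fun X =>
        zmass Prod.fst θ WB WM (ftime (PEv.step ∘ Prod.fst) X) X).sum ≤
      umass Prod.fst WB WM (P.genT c) / (1 - θ) :=
  sum_joins_zmass_le hθ0 hθ1 hB hM (dated_strict_genT hH c (Nat.lt_succ_self (P.step c))) (chronoZ_genT hH c)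

/-- **THE TOTAL FOR A TAGGED GENEALOGY WITH THE LAW'S ADDITIVE CONSTANT**:
`Σ_{X ∈ joins} Σ_{Q ∈ tparts X} (zmass (ftime X) Q + γ) ≤ umass ∕ (1 − θ) + 2γ·nmerges`. [folklore] -/
theorem sum_joins_tparts_zmass_add_le_genT (hθ0 : 0 ≤ θ) (hθ1 : θ < 1) (hB : 0 ≤ WB) (hM : 0 ≤ WM) {γ : ℝ}
    (hγ : 0 ≤ γ) (hH : ∀ c, P.HeadOldest c) (c : α) :
    ((joins (PEv.step ∘ Prod.fst) (P.genT c)).map fun X =>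
        ((tparts (PEv.step ∘ Prod.fst) X).map fun Q =>
          zmass Prod.fst θ WB WM (ftime (PEv.step ∘ Prod.fst) X) Q + γ).sum).sum ≤
      umass Prod.fst WB WM (P.genT c) / (1 - θ) + 2 * γ * (nmerges (P.genT c) : ℝ) :=
  sum_joins_tparts_zmass_add_le hθ0 hθ1 hB hM hγ (dated_strict_genT hH c (Nat.lt_succ_self (P.step c)))
    (chronoZ_genT hH c)

/-- **THE TOTAL FOR A TAGGED GENEALOGY, FINSET FORM** (the `hZtot` ∕ `MS` budget of the binding for the member
`P.genT c`): from «oldest line first» only. [folklore] -/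
theorem finset_sum_joins_le_genT (hθ0 : 0 ≤ θ) (hθ1 : θ < 1) (hB : 0 ≤ WB) (hM : 0 ≤ WM) {γ : ℝ} (hγ : 0 ≤ γ)
    (hH : ∀ c, P.HeadOldest c) (c : α) :
    ∑ X ∈ (joins (PEv.step ∘ Prod.fst) (P.genT c)).toFinset,
        ((tparts (PEv.step ∘ Prod.fst) X).map fun Q =>
          zmass Prod.fst θ WB WM (ftime (PEv.step ∘ Prod.fst) X) Q + γ).sum ≤
      umass Prod.fst WB WM (P.genT c) / (1 - θ) + 2 * γ * (nmerges (P.genT c) : ℝ) :=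
  finset_sum_joins_le hθ0 hθ1 hB hM hγ (dated_strict_genT hH c (Nat.lt_succ_self (P.step c))) (chronoZ_genT hH c)

/-! ## Sanity (closed arithmetic on the tagged tree of file 4's toy pedigree) -/

namespace Sanity

/-- the tagged tree a two-component pedigree produces (a region of class 3 born at 2, renewed at 5 and joined with a
new region of class 1; labels in `Lab (Fin 2) Unit`), written out: its undecayed mass at `WB = WM = 1` is
`(3+1) + (1+1) + 1 = 7`, it has one merge node and two births — the right-hand side of the END is `7∕(1−θ) + 2γ` -/
example :
    umass (Prod.fst : Lab (Fin 2) Unit → PEv) 1 1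
        (Gen.merge (Gen.renew (Gen.born ((((2, 0, 3) : PEv), Tag.birth (0 : Fin 2) 0 3 ())) 2)
          ((((5, 1, 0) : PEv), Tag.ren (1 : Fin 2) 0)) 2)
          (Gen.born ((((5, 0, 1) : PEv), Tag.birth (1 : Fin 2) 1 1 ())) 5) ((((5, 2, 0) : PEv), Tag.mer (1 : Fin 2) 0))) = 7 ∧
    nmerges (Gen.merge (Gen.renew (Gen.born ((((2, 0, 3) : PEv), Tag.birth (0 : Fin 2) 0 3 ())) 2)
          ((((5, 1, 0) : PEv), Tag.ren (1 : Fin 2) 0)) 2)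
          (Gen.born ((((5, 0, 1) : PEv), Tag.birth (1 : Fin 2) 1 1 ())) 5) ((((5, 2, 0) : PEv), Tag.mer (1 : Fin 2) 0))) = 1 := by
  refine ⟨by norm_num [umass, PEv.fat], by decide⟩

end Sanity

end

end Summit.QuantumFields.BalabanUV.T4Continuum.HistoryZoneMassTotalGen
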